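/-
Copyright (c) 2026 the pub-hodgecm-mathlib formalisation cell (harness21).  Prover seat hodgecm-mathlib-R90-C10-p07 (g2) acting for R90-TF section S8 «ContSpec-n½»
(dealer R90-CS-plan (g2), successor brief of record S8-R95, memo `R90/S8/CENSUS-IwasawaInertU3.R90-C10-p07-g0.md`): FILE 2 of 2 — the torus-entry letter (α) of
★ `K2E1ChiLocalWeightShellU3` and the Iwasawa reading of its weight letter (c), in the S8 chain's base coordinates, from ★ FILE 1 `K2E1BigCellIwasawaTorusEntryU3`.
-/
import Summits.HodgeConjecture.HodgeConjecture.Theorems.K2E1BigCellIwasawaTorusEntryU3   -- ★ FILE 1 (p863210): `exists_borel_mul_integral_eq_weylLong_mul_of_nonsplit`, `heis_mem_of_rel`, `heis_rel_of_mem`, `heis_inv_val`, `antidiag_inv_val`; brings ★ `K2E1IntertwiningLocalMeanCMU3`, ★ `K2E1IntertwiningLocalFactorU3Height`, ★ `HeisenbergChartAtNonsplitPlace`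
import HarnessLib

/-!
# K2·E1 ∕ R90·S8 — `K2E1BigCellIwasawaTorusEntryU3Letters`: THE TORUS-ENTRY LETTER (α) — `‖α(p)‖_w · Q_v(p) = 1` — AND THE IWASAWA READING OF THE WEIGHT LETTER (c) AT AN INERT PLACE

Cell `pub/hodgecm-mathlib`, crux h413 = `stmt-HodgeConjecture-24833`, route of record `HCCMUnconditional`; R90-TF section S8 «ContSpec-n½» (the (NV) road of socket #3:
★ (a-1) `K2E1ChiIntertwiningScalarEulerProductU3Finite` ← ★ B1-local `K2E1ChiIntertwiningLocalScalarU3` ← ★ (W) `K2E1ChiLocalWeightShellU3.shell_nonsplit_of_torusEntry` ← THIS FILE ← ★ FILE 1).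
THEOREMS ONLY (no `def`, no `instance`, no notation, no named-fact hypothesis, no `sorry`; default heartbeats); lane `--supports stmt-HodgeConjecture-24833 --as helper` (count-neutral).

THE MATHEMATICS ([Rogawski1990] §1.10 p. 9, §4.5 p. 45; [Casselman1980] §3; [MoeglinWaldspurger1995] II.1.6).  `L` CM, `v` a finite place of `L⁺` UNRAMIFIED and NON-SPLIT in `L`
(`w` the place above it), `v ∤ 2`, `δ ∈ L⁻` a `w`-unit; base coordinates `p = (a, b, t) ∈ L⁺_v³` of the S8 chain: `X(p) = Ψ_v(a, b) = ι a + ι b·δ`, `Z(p) = ι t·δ − ½·X·σX` (the corner of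
`u(X, Z)`), local height `Q_v(p) = ∏_{w'∣v} max(1, ‖X_{w'}‖, ‖Z_{w'}‖)` (★ `K2E1IntertwiningLocalMeanCMU3` bytes).  Since `|X_w| = max(|a|,|b|)` and `|Z_w| = max(max(|a|,|b|)², |t|)`
(★ `K2E1IntertwiningLocalFactorU3Height`), `|X_w|² ≤ |Z_w|`, so OFF THE UNIT SHELL (`Q_v(p) > 1`) the height is the corner, `Q_v(p) = ‖Z_w‖`, with `1 ≤ |Z_w|`, `|X_w| ≤ |Z_w|`
(`localHeight_eq_normAbs_corner_of_one_lt`) — exactly the regime of ★ FILE 1's Iwasawa factorisation `w₀·u(X,Z) = b·k`, `b₀₀ = σ(Z)⁻¹`, `k ∈ K_v`; ON the unit shell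
(`Q_v(p) = 1`) `X_w, Z_w` are integral and `w₀·u(X, Z) ∈ K_v`.  HEAD **`exists_torusEntry_iwasawa_letters`**: a torus-entry function `α : L⁺_v³ → L_w^×`, `α(p) = σ(Z(p))_w⁻¹`
off the unit shell, with (α) **`‖α(p)‖_w · Q_v(p) = 1` for `Q_v(p) > 1`** — the hypothesis `hα` of ★ `shell_nonsplit_of_torusEntry`, byte for byte; (c-off) `w₀·u(p) = b·k`, `b ∈ B(L⁺_v)`,
`k ∈ K_v`, `(b₀₀)_w = α(p)` for `Q_v(p) > 1`; (c-on) `w₀·u(p) ∈ K_v` for `Q_v(p) = 1`.  So for any right-`K_v`-invariant `φ` on `U(Φ₃)(L⁺_v)` with `φ(bg) = χ̃(proj b)φ(g)` the big-cell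
weight `ω(p) := φ(w₀ u(p))∕φ(1)` is `1` on the unit shell and `χ̃(proj b)` off it, first coordinate of `proj b` at `w` being `α(p)` (★ `coe_torusEntry_proj_borelTriple`) — the letters
`hω1 ∕ hωQ` of ★ (W) once the consumer fixes its `φ` and `χ̃ = χ_w ∘ (·)₀₀,w` ((a-2)'s section-factorisation business; not typed here).
Also: `corner_rel` (`Z + σZ + XσX = 0`, every `X`, `t`), `exists_heis_of_corner` (the element `u(X, Z) ∈ U(Φ₃)(L⁺_v)` exists, chart-free), `heis_mem_integralLevel_of_valued_le_one`,
`antidiag_mem_integralLevel` (`w₀ ∈ K_v`).  `w₀` = ANY element of matrix `Φ₃` (★ `weylLongU` needs a `Field` instance the CM local ring lacks; the element is determined by its matrix).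
HONEST LABEL: HC_CM is proved only modulo the 7 printed citations (2 remaining named inputs: hLiu418 = `stmt-HodgeConjecture-24832`, h413 = `stmt-HodgeConjecture-24833`) until rung 0
closes; this file asserts no named fact and closes no socket; it pays the inert (α) letter and the group-theoretic content of (c); count-neutral; unconditional.

## References
* [Rogawski1990] J. D. Rogawski, *Automorphic Representations of Unitary Groups in Three Variables*, Ann. of Math. Stud. 123 (1990), §1.10 p. 9, §4.5 p. 45.
* [Casselman1980] W. Casselman, *The unramified principal series of p-adic groups I*, Compositio Math. 40 (1980), §3.
* [MoeglinWaldspurger1995] C. Mœglin, J.-L. Waldspurger, *Spectral Decomposition and Eisenstein Series* (1995), II.1.6.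
-/

set_option autoImplicit false
set_option linter.dupNamespace false -- the mandated namespace repeats `HodgeConjecture.HodgeConjecture`

noncomputable section

open NumberField IsDedekindDomain
open scoped NNReal Matrix
open Literature.NumberTheory.Automorphic Literature.NumberTheory.Automorphic.UnitaryGroup
open Summit.HodgeConjecture.HodgeConjecture.Cruxes.H413.K2E1BigCellIwasawaTorusEntryU3

namespace Summit.HodgeConjecture.HodgeConjecture.Cruxes.H413.K2E1BigCellIwasawaTorusEntryU3Letters

/-! ## §1 Two more ring-generic matrix identities (`u(x,z)` and its inverse) -/

section RingGenericTwo

variable {R : Type*} [CommRing R] (σ : R →+* R)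

/-- `u(x, z) · (1  −x  σz; 0  1  σx; 0 0 1) = 1` for `z + σz + xσx = 0`. [cite: Rogawski1990, §1.10 p. 9] -/
theorem heis_mul_heisInv {x z : R} (hrel : z + σ z + x * σ x = 0) :
    (!![1, x, z; 0, 1, -σ x; 0, 0, 1] : Matrix (Fin 3) (Fin 3) R) * !![1, -x, σ z; 0, 1, σ x; 0, 0, 1] = 1 := by
  ext i j
  fin_cases i <;> fin_cases j <;> simp [Matrix.mul_apply, Fin.sum_univ_three, Matrix.cons_val_zero, Matrix.cons_val_one]
  linear_combination hrel

/-- `(1  −x  σz; 0  1  σx; 0 0 1) · u(x, z) = 1` for `z + σz + xσx = 0`. [cite: Rogawski1990, §1.10 p. 9] -/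
theorem heisInv_mul_heis {x z : R} (hrel : z + σ z + x * σ x = 0) :
    (!![1, -x, σ z; 0, 1, σ x; 0, 0, 1] : Matrix (Fin 3) (Fin 3) R) * !![1, x, z; 0, 1, -σ x; 0, 0, 1] = 1 := by
  ext i j
  fin_cases i <;> fin_cases j <;> simp [Matrix.mul_apply, Fin.sum_univ_three, Matrix.cons_val_zero, Matrix.cons_val_one]
  linear_combination hrel

end RingGenericTwo

/-! ## §2 Base coordinates: the corner relation, the element `u(X, Z)`, `|X_w|² ≤ |Z_w|`, `Q_v = ‖Z_w‖` off the unit shell; §3 HEAD -/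

section Letters

open Literature.NumberTheory.GaloisRepresentations.IsNonarchimedeanLocalField
open Summit.HodgeConjecture.HodgeConjecture.Cruxes.H413.K2E1IntertwiningLocalFactorU3Height (valued_corner_eq_max valued_quadraticLocalEquiv_apply_eq_max)
open Summit.HodgeConjecture.HodgeConjecture.Cruxes.H413.K2E1IntertwiningLocalMeanCMU3 (placesOver_good)

variable (L : Type) [Field L] [NumberField L] [IsCMField L] {δ : L} (hcδ : IsCMField.complexConj L δ = -δ) (hδ : δ ≠ 0)
  {d : ↥(maximalRealSubfield L)} (hd : δ * δ = algebraMap ↥(maximalRealSubfield L) L d)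
  (v : HeightOneSpectrum (𝓞 ↥(maximalRealSubfield L))) (w : PlacesOver L v)

include hcδ in
/-- **The Heisenberg relation of the corner** `Z = ι t·δ − ι(½)·X·σX`: `Z + σZ + X·σX = 0` for EVERY `X ∈ L ⊗ L⁺_v` and `t ∈ L⁺_v` (`σ` fixes `ι(L⁺_v)`, `σ δ = −δ`, `σσ = 1`, `½ + ½ = 1`).
[cite: Rogawski1990, §1.10 p. 9] -/
theorem corner_rel (X : LocalRing L v) (t : v.adicCompletion ↥(maximalRealSubfield L)) :
    (toLocalRing L v t * algebraMap L (LocalRing L v) δ - toLocalRing L v 2⁻¹ * (X * conjLocal L (IsCMField.complexConj L) v X)) +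
        conjLocal L (IsCMField.complexConj L) v (toLocalRing L v t * algebraMap L (LocalRing L v) δ - toLocalRing L v 2⁻¹ * (X * conjLocal L (IsCMField.complexConj L) v X)) +
      X * conjLocal L (IsCMField.complexConj L) v X = 0 := by
  have hσ := conjLocal_conjLocal_cm L v
  have h2 : toLocalRing L v (2⁻¹ : v.adicCompletion ↥(maximalRealSubfield L)) + toLocalRing L v 2⁻¹ = 1 := by
    rw [← two_mul, ← map_ofNat (toLocalRing L v) 2, ← map_mul, mul_inv_cancel₀ two_ne_zero, map_one]
  rw [map_sub, map_mul, map_mul, map_mul, conjLocal_toLocalRing, conjLocal_toLocalRing, conjLocal_algebraMap, hcδ, map_neg, hσ]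
  linear_combination (-(X * conjLocal L (IsCMField.complexConj L) v X)) * h2

include hcδ in
/-- **The big-cell point `u(X, Z)` EXISTS in `U(Φ₃)(L⁺_v)` for every `X ∈ L ⊗ L⁺_v`, `t ∈ L⁺_v`** (`Z = ι t·δ − ι(½) X σX`; inverse `(1 −X σZ; 0 1 σX; 0 0 1)`, unitarity by `heis_mem_of_rel`) —
chart-free (no `Invertible 2` instance needed; it is ★ `HeisRing.heisElt X (ι t·δ)` whenever that chart is instantiated, both having the same matrix). [cite: Rogawski1990, §1.10 p. 9] -/
theorem exists_heis_of_corner (X : LocalRing L v) (t : v.adicCompletion ↥(maximalRealSubfield L)) :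
    ∃ n : ↥(unitaryGroupOfForm (conjLocal L (IsCMField.complexConj L) v) (cmLocalForm L 3 v)),
      (n : GL (Fin 3) (LocalRing L v)).val = !![1, X, toLocalRing L v t * algebraMap L (LocalRing L v) δ - toLocalRing L v 2⁻¹ * (X * conjLocal L (IsCMField.complexConj L) v X);
        0, 1, -conjLocal L (IsCMField.complexConj L) v X; 0, 0, 1] := by
  have hrel := corner_rel L hcδ v X t
  refine ⟨⟨⟨_, _, heis_mul_heisInv _ hrel, heisInv_mul_heis _ hrel⟩, ?_⟩, rfl⟩
  rw [cmLocalForm_eq_over]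
  exact heis_mem_of_rel _ (conjLocal_conjLocal_cm L v) hrel rfl

include hd in
/-- **`|X_w|² ≤ |Z_w|` and the off-shell dichotomy in base coordinates** (`v ∤ 2` non-split, unramified in `L`, `δ` a `w`-unit; `X = Ψ_v(a,b)`, `Z = ι t·δ − ½XσX`): `|X_w| = max(|a|,|b|)` and
`|Z_w| = max(max(|a|,|b|)², |t|)` (★ `valued_quadraticLocalEquiv_apply_eq_max`, ★ `valued_corner_eq_max`), hence if `1 ≤ max(|X_w|, |Z_w|)` then `1 ≤ |Z_w|` and `|X_w| ≤ |Z_w|`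
— the hypotheses of `exists_borel_mul_integral_eq_weylLong_mul_of_nonsplit`. [cite: Rogawski1990, §4.5 p. 45] -/
theorem valued_corner_of_one_le_max (hw : IsCMField.complexConj L • w.1 = w.1) (he : v.asIdeal.ramificationIdx' w.1.asIdeal = 1)
    (h2 : Valued.v (2 : v.adicCompletion ↥(maximalRealSubfield L)) = 1) (hδu : Valued.v (algebraMap L (LocalRing L v) δ w) = 1) (a b t : v.adicCompletion ↥(maximalRealSubfield L))
    (h1 : 1 ≤ max (Valued.v (quadraticLocalEquiv L v (IsCMField.complexConj L) hcδ hδ (a, b) w))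
      (Valued.v ((toLocalRing L v t * algebraMap L (LocalRing L v) δ -
        toLocalRing L v 2⁻¹ * (quadraticLocalEquiv L v (IsCMField.complexConj L) hcδ hδ (a, b) * conjLocal L (IsCMField.complexConj L) v (quadraticLocalEquiv L v (IsCMField.complexConj L) hcδ hδ (a, b)))) w))) :
    1 ≤ Valued.v ((toLocalRing L v t * algebraMap L (LocalRing L v) δ -
        toLocalRing L v 2⁻¹ * (quadraticLocalEquiv L v (IsCMField.complexConj L) hcδ hδ (a, b) * conjLocal L (IsCMField.complexConj L) v (quadraticLocalEquiv L v (IsCMField.complexConj L) hcδ hδ (a, b)))) w) ∧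
      Valued.v (quadraticLocalEquiv L v (IsCMField.complexConj L) hcδ hδ (a, b) w) ≤
        Valued.v ((toLocalRing L v t * algebraMap L (LocalRing L v) δ -
          toLocalRing L v 2⁻¹ * (quadraticLocalEquiv L v (IsCMField.complexConj L) hcδ hδ (a, b) * conjLocal L (IsCMField.complexConj L) v (quadraticLocalEquiv L v (IsCMField.complexConj L) hcδ hδ (a, b)))) w) := by
  haveI : Algebra.IsQuadraticExtension ↥(maximalRealSubfield L) L := IsCMField.isQuadraticExtension L
  rw [valued_corner_eq_max L (IsCMField.complexConj L) hcδ hδ hd v w hw he h2 hδu,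
    valued_quadraticLocalEquiv_apply_eq_max L (IsCMField.complexConj L) hcδ hδ hd v w hw he h2 hδu] at h1 ⊢
  set M := max (Valued.v a) (Valued.v b) with hM
  rcases le_or_gt M 1 with hM1 | hM1
  · -- `M ≤ 1`: then `1 ≤ max(M², |t|)` (if `|t| < 1` the hypothesis forces `M = 1`)
    have hZ : 1 ≤ max (M ^ 2) (Valued.v t) := by
      rcases le_or_gt 1 (Valued.v t) with ht | ht
      · exact le_max_of_le_right ht
      · have hM' : M = 1 := by
          refine le_antisymm hM1 ?_
          rcases le_max_iff.1 h1 with h | h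
          · exact h
          · rcases le_max_iff.1 h with h' | h'
            · by_contra hlt
              push Not at hlt
              exact absurd h' (not_le.2 (by simpa [sq] using mul_lt_one_of_nonneg_of_lt_one_left zero_le hlt hlt.le))
            · exact absurd h' (not_le.2 ht)
        rw [hM', one_pow]
        exact le_max_left _ _
    exact ⟨hZ, hM1.trans hZ⟩
  · -- `1 < M`: `M ≤ M² ≤ max(M², |t|)`
    have hMM : M ≤ M ^ 2 := by rw [sq]; exact le_mul_of_one_le_left zero_le hM1.le
    exact ⟨hM1.le.trans (hMM.trans (le_max_left _ _)), hMM.trans (le_max_left _ _)⟩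

omit [IsCMField L] in
/-- `‖y‖_w ≤ ‖y'‖_w ↔ |y|_w ≤ |y'|_w` and `1 = ‖1‖`: `1 < ‖y‖_w ↔ 1 < |y|_w`. [folklore] -/
theorem one_lt_coe_normAbs_iff (y : w.1.adicCompletion L) : (1 : ℝ) < ((normAbs (w.1.adicCompletion L) y : ℝ≥0) : ℝ) ↔ 1 < Valued.v y := by
  rw [← not_le, ← not_le, not_iff_not, show (1 : ℝ) = ((normAbs (w.1.adicCompletion L) 1 : ℝ≥0) : ℝ) by rw [map_one, NNReal.coe_one], NNReal.coe_le_coe,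
    normAbs_le_normAbs_iff_valued, Valuation.map_one]

omit [IsCMField L] in
/-- `‖y‖_w ≤ 1 ↔ |y|_w ≤ 1`. [folklore] -/
theorem coe_normAbs_le_one_iff (y : w.1.adicCompletion L) : ((normAbs (w.1.adicCompletion L) y : ℝ≥0) : ℝ) ≤ 1 ↔ Valued.v y ≤ 1 := by
  rw [show (1 : ℝ) = ((normAbs (w.1.adicCompletion L) 1 : ℝ≥0) : ℝ) by rw [map_one, NNReal.coe_one], NNReal.coe_le_coe, normAbs_le_normAbs_iff_valued, Valuation.map_one]

include hd in
/-- **OFF THE UNIT SHELL THE HEIGHT IS THE CORNER: `Q_v(p) = ‖Z_w‖`**, together with `1 ≤ |Z_w|`, `|X_w| ≤ |Z_w|` (the Iwasawa regime of FILE 1 §2).  Here `Q_v(p) = ∏_{w'∣v} max(1, ‖X_{w'}‖, ‖Z_{w'}‖)` in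
the S8 chain's exact bytes (★ `K2E1IntertwiningLocalMeanCMU3`), one place above the non-split `v`. [cite: Rogawski1990, §4.5 p. 45] [cite: Casselman1980, §3] -/
theorem localHeight_eq_normAbs_corner_of_one_lt (hunr : Algebra.IsUnramifiedIn (𝓞 L) v.asIdeal) (hw : IsCMField.complexConj L • w.1 = w.1)
    (h2 : Valued.v (2 : v.adicCompletion ↥(maximalRealSubfield L)) = 1) (hδu : Valued.v (algebraMap L (LocalRing L v) δ w) = 1) (p : Fin 3 → v.adicCompletion ↥(maximalRealSubfield L))
    (hQ : 1 < (∏ w' : PlacesOver L v, max 1 (max ((normAbs (w'.1.adicCompletion L) (quadraticLocalEquiv L v (IsCMField.complexConj L) hcδ hδ (p 0, p 1) w') : ℝ≥0) : ℝ)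
          ((normAbs (w'.1.adicCompletion L) ((toLocalRing L v (p 2) * algebraMap L (LocalRing L v) δ -
            toLocalRing L v 2⁻¹ * (quadraticLocalEquiv L v (IsCMField.complexConj L) hcδ hδ (p 0, p 1) *
              conjLocal L (IsCMField.complexConj L) v (quadraticLocalEquiv L v (IsCMField.complexConj L) hcδ hδ (p 0, p 1)))) w') : ℝ≥0) : ℝ)))) :
    1 ≤ Valued.v ((toLocalRing L v (p 2) * algebraMap L (LocalRing L v) δ -
        toLocalRing L v 2⁻¹ * (quadraticLocalEquiv L v (IsCMField.complexConj L) hcδ hδ (p 0, p 1) * conjLocal L (IsCMField.complexConj L) v (quadraticLocalEquiv L v (IsCMField.complexConj L) hcδ hδ (p 0, p 1)))) w) ∧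
      Valued.v (quadraticLocalEquiv L v (IsCMField.complexConj L) hcδ hδ (p 0, p 1) w) ≤
        Valued.v ((toLocalRing L v (p 2) * algebraMap L (LocalRing L v) δ -
          toLocalRing L v 2⁻¹ * (quadraticLocalEquiv L v (IsCMField.complexConj L) hcδ hδ (p 0, p 1) * conjLocal L (IsCMField.complexConj L) v (quadraticLocalEquiv L v (IsCMField.complexConj L) hcδ hδ (p 0, p 1)))) w) ∧
      (∏ w' : PlacesOver L v, max 1 (max ((normAbs (w'.1.adicCompletion L) (quadraticLocalEquiv L v (IsCMField.complexConj L) hcδ hδ (p 0, p 1) w') : ℝ≥0) : ℝ)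
          ((normAbs (w'.1.adicCompletion L) ((toLocalRing L v (p 2) * algebraMap L (LocalRing L v) δ -
            toLocalRing L v 2⁻¹ * (quadraticLocalEquiv L v (IsCMField.complexConj L) hcδ hδ (p 0, p 1) *
              conjLocal L (IsCMField.complexConj L) v (quadraticLocalEquiv L v (IsCMField.complexConj L) hcδ hδ (p 0, p 1)))) w') : ℝ≥0) : ℝ))) =
        ((normAbs (w.1.adicCompletion L) ((toLocalRing L v (p 2) * algebraMap L (LocalRing L v) δ -
            toLocalRing L v 2⁻¹ * (quadraticLocalEquiv L v (IsCMField.complexConj L) hcδ hδ (p 0, p 1) *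
              conjLocal L (IsCMField.complexConj L) v (quadraticLocalEquiv L v (IsCMField.complexConj L) hcδ hδ (p 0, p 1)))) w) : ℝ≥0) : ℝ) := by
  haveI : Algebra.IsQuadraticExtension ↥(maximalRealSubfield L) L := IsCMField.isQuadraticExtension L
  haveI : Subsingleton (PlacesOver L v) := PlacesOver.subsingleton_of_smul_eq (IsCMField.complexConj L) (IsCMField.complexConj_ne_one L) w hw
  obtain ⟨he, -⟩ := placesOver_good L v hunr w
  rw [Fintype.prod_subsingleton _ w] at hQ ⊢
  -- abbreviate the two norms and the two valuations
  set nX := ((normAbs (w.1.adicCompletion L) (quadraticLocalEquiv L v (IsCMField.complexConj L) hcδ hδ (p 0, p 1) w) : ℝ≥0) : ℝ) with hnX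
  set nZ := ((normAbs (w.1.adicCompletion L) ((toLocalRing L v (p 2) * algebraMap L (LocalRing L v) δ -
            toLocalRing L v 2⁻¹ * (quadraticLocalEquiv L v (IsCMField.complexConj L) hcδ hδ (p 0, p 1) *
              conjLocal L (IsCMField.complexConj L) v (quadraticLocalEquiv L v (IsCMField.complexConj L) hcδ hδ (p 0, p 1)))) w) : ℝ≥0) : ℝ) with hnZ
  -- `1 < max(‖X‖, ‖Z‖)` in valuations
  have h1 : 1 < max nX nZ := by
    rcases lt_max_iff.1 hQ with h | h
    · exact absurd h (lt_irrefl _)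
    · exact h
  have h1v : 1 ≤ max (Valued.v (quadraticLocalEquiv L v (IsCMField.complexConj L) hcδ hδ (p 0, p 1) w))
      (Valued.v ((toLocalRing L v (p 2) * algebraMap L (LocalRing L v) δ -
        toLocalRing L v 2⁻¹ * (quadraticLocalEquiv L v (IsCMField.complexConj L) hcδ hδ (p 0, p 1) * conjLocal L (IsCMField.complexConj L) v (quadraticLocalEquiv L v (IsCMField.complexConj L) hcδ hδ (p 0, p 1)))) w)) := by
    rcases lt_max_iff.1 h1 with h | h
    · exact le_max_of_le_left ((one_lt_coe_normAbs_iff L v w _).1 h).le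
    · exact le_max_of_le_right ((one_lt_coe_normAbs_iff L v w _).1 h).le
  obtain ⟨hZ1, hXZ⟩ := valued_corner_of_one_le_max L hcδ hδ hd v w hw he h2 hδu (p 0) (p 1) (p 2) h1v
  refine ⟨hZ1, hXZ, ?_⟩
  have hXZ' : nX ≤ nZ := by
    rw [hnX, hnZ, NNReal.coe_le_coe, normAbs_le_normAbs_iff_valued]
    exact hXZ
  have hZgt : 1 < nZ := lt_of_lt_of_le h1 (max_le hXZ' le_rfl)
  rw [max_eq_right hXZ', max_eq_right hZgt.le]

/-- **ON THE UNIT SHELL `X_w`, `Z_w` ARE INTEGRAL**: `Q_v(p) = 1 ⟹ |X_w| ≤ 1 ∧ |Z_w| ≤ 1` (one place above `v`). [cite: Rogawski1990, §4.5 p. 45] -/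
theorem valued_le_one_of_localHeight_eq_one (hw : IsCMField.complexConj L • w.1 = w.1) (p : Fin 3 → v.adicCompletion ↥(maximalRealSubfield L))
    (hQ : (∏ w' : PlacesOver L v, max 1 (max ((normAbs (w'.1.adicCompletion L) (quadraticLocalEquiv L v (IsCMField.complexConj L) hcδ hδ (p 0, p 1) w') : ℝ≥0) : ℝ)
          ((normAbs (w'.1.adicCompletion L) ((toLocalRing L v (p 2) * algebraMap L (LocalRing L v) δ -
            toLocalRing L v 2⁻¹ * (quadraticLocalEquiv L v (IsCMField.complexConj L) hcδ hδ (p 0, p 1) *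
              conjLocal L (IsCMField.complexConj L) v (quadraticLocalEquiv L v (IsCMField.complexConj L) hcδ hδ (p 0, p 1)))) w') : ℝ≥0) : ℝ))) = 1) :
    Valued.v (quadraticLocalEquiv L v (IsCMField.complexConj L) hcδ hδ (p 0, p 1) w) ≤ 1 ∧
      Valued.v ((toLocalRing L v (p 2) * algebraMap L (LocalRing L v) δ -
        toLocalRing L v 2⁻¹ * (quadraticLocalEquiv L v (IsCMField.complexConj L) hcδ hδ (p 0, p 1) * conjLocal L (IsCMField.complexConj L) v (quadraticLocalEquiv L v (IsCMField.complexConj L) hcδ hδ (p 0, p 1)))) w) ≤ 1 := by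
  haveI : Algebra.IsQuadraticExtension ↥(maximalRealSubfield L) L := IsCMField.isQuadraticExtension L
  haveI : Subsingleton (PlacesOver L v) := PlacesOver.subsingleton_of_smul_eq (IsCMField.complexConj L) (IsCMField.complexConj_ne_one L) w hw
  rw [Fintype.prod_subsingleton _ w] at hQ
  have h := le_of_eq hQ
  rw [max_le_iff, max_le_iff] at h
  exact ⟨(coe_normAbs_le_one_iff L v w _).1 h.2.1, (coe_normAbs_le_one_iff L v w _).1 h.2.2⟩


include w in
/-- **`u(x, z) ∈ K_v` for `w`-integral `x, z`** at a non-split `v` (entries of `u` and of `u⁻¹ = (1 −x σz; 0 1 σx; 0 0 1)` are `1, 0, ±x, ±σx, z, σz`; `|σ y|_w = |y|_w`). [cite: Rogawski1990, §1.10 p. 9; §4.5 p. 45] -/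
theorem heis_mem_integralLevel_of_valued_le_one (hw : IsCMField.complexConj L • w.1 = w.1) {x z : LocalRing L v}
    {n : ↥(unitaryGroupOfForm (conjLocal L (IsCMField.complexConj L) v) (cmLocalForm L 3 v))}
    (hn : (n : GL (Fin 3) (LocalRing L v)).val = !![1, x, z; 0, 1, -conjLocal L (IsCMField.complexConj L) v x; 0, 0, 1])
    (hx : Valued.v (x w) ≤ 1) (hz : Valued.v (z w) ≤ 1) :
    n ∈ cmLocalIntegralLevel L 3 (Matrix.of fun i j : Fin 3 => if i.val + j.val + 1 = 3 then (1 : L) else 0) v := by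
  haveI : Algebra.IsQuadraticExtension ↥(maximalRealSubfield L) L := IsCMField.isQuadraticExtension L
  haveI : Subsingleton (PlacesOver L v) := PlacesOver.subsingleton_of_smul_eq (IsCMField.complexConj L) (IsCMField.complexConj_ne_one L) w hw
  have hσ := conjLocal_conjLocal_cm L v
  have hv : ∀ y : LocalRing L v, Valued.v (conjLocal L (IsCMField.complexConj L) v y w) = Valued.v (y w) := valued_conjLocal_apply_of_smul_eq L v w hw
  have hnU : (n : GL (Fin 3) (LocalRing L v)) ∈ unitaryGroupOfForm (conjLocal L (IsCMField.complexConj L) v) ((StdForm.antidiagonal 3).over (LocalRing L v)) := by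
    rw [← cmLocalForm_eq_over]; exact n.2
  have hrel := heis_rel_of_mem _ hσ hn hnU
  have hninv : (((n⁻¹ : ↥(unitaryGroupOfForm (conjLocal L (IsCMField.complexConj L) v) (cmLocalForm L 3 v))) : GL (Fin 3) (LocalRing L v))).val =
      !![1, -x, conjLocal L (IsCMField.complexConj L) v z; 0, 1, conjLocal L (IsCMField.complexConj L) v x; 0, 0, 1] := by
    rw [Subgroup.coe_inv]; exact heis_inv_val _ hrel hn
  refine (mem_cmLocalIntegralLevel_iff_forall_v_le_one L 3 v _).2 ⟨fun i j w' => ?_, fun i j w' => ?_⟩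
  · rw [Subsingleton.elim w' w, hn]
    fin_cases i <;> fin_cases j <;> simp [-conjLocal_apply, hv, hx, hz]
  · rw [Subsingleton.elim w' w, hninv]
    fin_cases i <;> fin_cases j <;> simp [-conjLocal_apply, hv, hx, hz]

/-- **`w₀ ∈ K_v`**: an element of matrix `Φ₃` (whose inverse also has matrix `Φ₃`) has entries `0, 1`. [cite: Rogawski1990, §1.10 p. 9] -/
theorem antidiag_mem_integralLevel {w₀ : ↥(unitaryGroupOfForm (conjLocal L (IsCMField.complexConj L) v) (cmLocalForm L 3 v))}
    (hw₀ : (w₀ : GL (Fin 3) (LocalRing L v)).val = !![(0 : LocalRing L v), 0, 1; 0, 1, 0; 1, 0, 0]) :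
    w₀ ∈ cmLocalIntegralLevel L 3 (Matrix.of fun i j : Fin 3 => if i.val + j.val + 1 = 3 then (1 : L) else 0) v := by
  have hinv : (((w₀⁻¹ : ↥(unitaryGroupOfForm (conjLocal L (IsCMField.complexConj L) v) (cmLocalForm L 3 v))) : GL (Fin 3) (LocalRing L v))).val =
      !![(0 : LocalRing L v), 0, 1; 0, 1, 0; 1, 0, 0] := by
    rw [Subgroup.coe_inv]; exact antidiag_inv_val hw₀
  refine (mem_cmLocalIntegralLevel_iff_forall_v_le_one L 3 v _).2 ⟨fun i j w' => ?_, fun i j w' => ?_⟩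
  · rw [hw₀]
    fin_cases i <;> fin_cases j <;> simp
  · rw [hinv]
    fin_cases i <;> fin_cases j <;> simp

include hd in
/-- **HEAD — THE TORUS-ENTRY LETTER (α) AND THE IWASAWA READING OF (c) AT AN INERT GOOD PLACE, in the S8 chain's base coordinates.**  `v` a finite place of `L⁺`
UNRAMIFIED in `L`, NON-SPLIT (`w ∣ v`, `c • w = w`), `|2|_v = 1`, `δ` a `w`-unit; `p = (a, b, t) ∈ L⁺_v³`, `X(p) = Ψ_v(a, b)`, `Z(p) = ι t·δ − ½ X σX`,
`Q_v(p) = ∏_{w'∣v} max(1, ‖X_{w'}‖, ‖Z_{w'}‖)` (★ `K2E1IntertwiningLocalMeanCMU3` bytes), `w₀ ∈ U(Φ₃)(L⁺_v)` the element of matrix `Φ₃`, `u(p) = u(X(p), Z(p))` (any element with that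
matrix, `exists_heis_of_corner`).  THEN there is a torus-entry function `α : L⁺_v³ → L_w^×` (`α(p) = σ(Z(p))_w⁻¹` off the unit shell) with
(α) `‖α(p)‖_w · Q_v(p) = 1` whenever `Q_v(p) > 1` — the letter `hα` of ★ `K2E1ChiLocalWeightShellU3.shell_nonsplit_of_torusEntry`, byte for byte;
(c-off) whenever `Q_v(p) > 1`: `w₀ · u(p) = b · k`, `b ∈ B(L⁺_v)`, `k ∈ K_v`, with `(b₀₀)_w = α(p)` — so a `K_v`-spherical, `(B, χ)`-equivariant `φ` has `φ(w₀ u(p)) = χ(proj b)·φ(1)`, first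
coordinate of `proj b` read at `w` equal to `α(p)` (★ `coe_torusEntry_proj_borelTriple`);
(c-on) whenever `Q_v(p) = 1`: `w₀ · u(p) ∈ K_v` (so `φ(w₀ u(p)) = φ(1)`: the weight is `1` on the unit shell, letter `hω1`).
[cite: Rogawski1990, §4.5 p. 45; §1.10 p. 9] [cite: Casselman1980, §3] [cite: MoeglinWaldspurger1995, II.1.6] -/
theorem exists_torusEntry_iwasawa_letters (hunr : Algebra.IsUnramifiedIn (𝓞 L) v.asIdeal) (hw : IsCMField.complexConj L • w.1 = w.1)
    (h2 : Valued.v (2 : v.adicCompletion ↥(maximalRealSubfield L)) = 1) (hδu : Valued.v (algebraMap L (LocalRing L v) δ w) = 1)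
    {w₀ : ↥(unitaryGroupOfForm (conjLocal L (IsCMField.complexConj L) v) (cmLocalForm L 3 v))}
    (hw₀ : (w₀ : GL (Fin 3) (LocalRing L v)).val = !![(0 : LocalRing L v), 0, 1; 0, 1, 0; 1, 0, 0]) :
    ∃ α : (Fin 3 → v.adicCompletion ↥(maximalRealSubfield L)) → (w.1.adicCompletion L)ˣ,
      (∀ p : Fin 3 → v.adicCompletion ↥(maximalRealSubfield L),
        1 < (∏ w' : PlacesOver L v, max 1 (max ((normAbs (w'.1.adicCompletion L) (quadraticLocalEquiv L v (IsCMField.complexConj L) hcδ hδ (p 0, p 1) w') : ℝ≥0) : ℝ)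
            ((normAbs (w'.1.adicCompletion L) ((toLocalRing L v (p 2) * algebraMap L (LocalRing L v) δ -
              toLocalRing L v 2⁻¹ * (quadraticLocalEquiv L v (IsCMField.complexConj L) hcδ hδ (p 0, p 1) *
                conjLocal L (IsCMField.complexConj L) v (quadraticLocalEquiv L v (IsCMField.complexConj L) hcδ hδ (p 0, p 1)))) w') : ℝ≥0) : ℝ))) →
        ((normAbs (w.1.adicCompletion L) (α p : w.1.adicCompletion L) : ℝ≥0) : ℝ) *
          (∏ w' : PlacesOver L v, max 1 (max ((normAbs (w'.1.adicCompletion L) (quadraticLocalEquiv L v (IsCMField.complexConj L) hcδ hδ (p 0, p 1) w') : ℝ≥0) : ℝ)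
            ((normAbs (w'.1.adicCompletion L) ((toLocalRing L v (p 2) * algebraMap L (LocalRing L v) δ -
              toLocalRing L v 2⁻¹ * (quadraticLocalEquiv L v (IsCMField.complexConj L) hcδ hδ (p 0, p 1) *
                conjLocal L (IsCMField.complexConj L) v (quadraticLocalEquiv L v (IsCMField.complexConj L) hcδ hδ (p 0, p 1)))) w') : ℝ≥0) : ℝ))) = 1) ∧
      (∀ p : Fin 3 → v.adicCompletion ↥(maximalRealSubfield L),
        1 < (∏ w' : PlacesOver L v, max 1 (max ((normAbs (w'.1.adicCompletion L) (quadraticLocalEquiv L v (IsCMField.complexConj L) hcδ hδ (p 0, p 1) w') : ℝ≥0) : ℝ)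
            ((normAbs (w'.1.adicCompletion L) ((toLocalRing L v (p 2) * algebraMap L (LocalRing L v) δ -
              toLocalRing L v 2⁻¹ * (quadraticLocalEquiv L v (IsCMField.complexConj L) hcδ hδ (p 0, p 1) *
                conjLocal L (IsCMField.complexConj L) v (quadraticLocalEquiv L v (IsCMField.complexConj L) hcδ hδ (p 0, p 1)))) w') : ℝ≥0) : ℝ))) →
        ∀ n : ↥(unitaryGroupOfForm (conjLocal L (IsCMField.complexConj L) v) (cmLocalForm L 3 v)),
          (n : GL (Fin 3) (LocalRing L v)).val = !![1, quadraticLocalEquiv L v (IsCMField.complexConj L) hcδ hδ (p 0, p 1),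
              toLocalRing L v (p 2) * algebraMap L (LocalRing L v) δ -
                toLocalRing L v 2⁻¹ * (quadraticLocalEquiv L v (IsCMField.complexConj L) hcδ hδ (p 0, p 1) * conjLocal L (IsCMField.complexConj L) v (quadraticLocalEquiv L v (IsCMField.complexConj L) hcδ hδ (p 0, p 1)));
              0, 1, -conjLocal L (IsCMField.complexConj L) v (quadraticLocalEquiv L v (IsCMField.complexConj L) hcδ hδ (p 0, p 1)); 0, 0, 1] →
          ∃ b k : ↥(unitaryGroupOfForm (conjLocal L (IsCMField.complexConj L) v) (cmLocalForm L 3 v)),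
            b ∈ borelU (conjLocal L (IsCMField.complexConj L) v) (cmLocalForm L 3 v) ∧
            k ∈ cmLocalIntegralLevel L 3 (Matrix.of fun i j : Fin 3 => if i.val + j.val + 1 = 3 then (1 : L) else 0) v ∧
            w₀ * n = b * k ∧ (b : GL (Fin 3) (LocalRing L v)).val 0 0 w = (α p : w.1.adicCompletion L)) ∧
      (∀ p : Fin 3 → v.adicCompletion ↥(maximalRealSubfield L),
        (∏ w' : PlacesOver L v, max 1 (max ((normAbs (w'.1.adicCompletion L) (quadraticLocalEquiv L v (IsCMField.complexConj L) hcδ hδ (p 0, p 1) w') : ℝ≥0) : ℝ)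
            ((normAbs (w'.1.adicCompletion L) ((toLocalRing L v (p 2) * algebraMap L (LocalRing L v) δ -
              toLocalRing L v 2⁻¹ * (quadraticLocalEquiv L v (IsCMField.complexConj L) hcδ hδ (p 0, p 1) *
                conjLocal L (IsCMField.complexConj L) v (quadraticLocalEquiv L v (IsCMField.complexConj L) hcδ hδ (p 0, p 1)))) w') : ℝ≥0) : ℝ))) = 1 →
        ∀ n : ↥(unitaryGroupOfForm (conjLocal L (IsCMField.complexConj L) v) (cmLocalForm L 3 v)),
          (n : GL (Fin 3) (LocalRing L v)).val = !![1, quadraticLocalEquiv L v (IsCMField.complexConj L) hcδ hδ (p 0, p 1),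
              toLocalRing L v (p 2) * algebraMap L (LocalRing L v) δ -
                toLocalRing L v 2⁻¹ * (quadraticLocalEquiv L v (IsCMField.complexConj L) hcδ hδ (p 0, p 1) * conjLocal L (IsCMField.complexConj L) v (quadraticLocalEquiv L v (IsCMField.complexConj L) hcδ hδ (p 0, p 1)));
              0, 1, -conjLocal L (IsCMField.complexConj L) v (quadraticLocalEquiv L v (IsCMField.complexConj L) hcδ hδ (p 0, p 1)); 0, 0, 1] →
          w₀ * n ∈ cmLocalIntegralLevel L 3 (Matrix.of fun i j : Fin 3 => if i.val + j.val + 1 = 3 then (1 : L) else 0) v) := by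
  classical
  haveI : Algebra.IsQuadraticExtension ↥(maximalRealSubfield L) L := IsCMField.isQuadraticExtension L
  have hv : ∀ y : LocalRing L v, Valued.v (conjLocal L (IsCMField.complexConj L) v y w) = Valued.v (y w) := valued_conjLocal_apply_of_smul_eq L v w hw
  have hn' : ∀ y : LocalRing L v, normAbs (w.1.adicCompletion L) (conjLocal L (IsCMField.complexConj L) v y w) = normAbs (w.1.adicCompletion L) (y w) := fun y =>
    le_antisymm ((normAbs_le_normAbs_iff_valued w.1 _ _).2 (hv y).le) ((normAbs_le_normAbs_iff_valued w.1 _ _).2 (hv y).ge)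
  -- the torus-entry function: `σ(Z(p))_w⁻¹` where that is a unit, `1` elsewhere (only the off-shell values are ever read)
  refine ⟨fun p => if h : conjLocal L (IsCMField.complexConj L) v (toLocalRing L v (p 2) * algebraMap L (LocalRing L v) δ -
      toLocalRing L v 2⁻¹ * (quadraticLocalEquiv L v (IsCMField.complexConj L) hcδ hδ (p 0, p 1) * conjLocal L (IsCMField.complexConj L) v (quadraticLocalEquiv L v (IsCMField.complexConj L) hcδ hδ (p 0, p 1)))) w = 0
      then 1 else Units.mk0 _ (inv_ne_zero h), fun p hQ => ?_, fun p hQ n hn => ?_, fun p hQ n hn => ?_⟩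
  · -- (α): `‖σ(Z)_w⁻¹‖ · Q = ‖Z_w‖⁻¹ · ‖Z_w‖ = 1`
    obtain ⟨hZ1, -, hQZ⟩ := localHeight_eq_normAbs_corner_of_one_lt L hcδ hδ hd v w hunr hw h2 hδu p hQ
    have hne : conjLocal L (IsCMField.complexConj L) v (toLocalRing L v (p 2) * algebraMap L (LocalRing L v) δ -
        toLocalRing L v 2⁻¹ * (quadraticLocalEquiv L v (IsCMField.complexConj L) hcδ hδ (p 0, p 1) * conjLocal L (IsCMField.complexConj L) v (quadraticLocalEquiv L v (IsCMField.complexConj L) hcδ hδ (p 0, p 1)))) w ≠ 0 := by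
      intro h0
      have := hv (toLocalRing L v (p 2) * algebraMap L (LocalRing L v) δ -
        toLocalRing L v 2⁻¹ * (quadraticLocalEquiv L v (IsCMField.complexConj L) hcδ hδ (p 0, p 1) * conjLocal L (IsCMField.complexConj L) v (quadraticLocalEquiv L v (IsCMField.complexConj L) hcδ hδ (p 0, p 1))))
      rw [h0, Valuation.map_zero] at this
      exact absurd hZ1 (by rw [← this]; exact not_le.2 zero_lt_one)
    dsimp only
    rw [dif_neg hne, Units.val_mk0, map_inv₀, hn', hQZ, NNReal.coe_inv, inv_mul_cancel₀]
    exact ne_of_gt (lt_trans zero_lt_one (by rw [← hQZ]; exact hQ))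
  · -- (c-off): FILE 1 §2 in the regime `1 ≤ |Z_w|`, `|X_w| ≤ |Z_w|`
    obtain ⟨hZ1, hXZ, -⟩ := localHeight_eq_normAbs_corner_of_one_lt L hcδ hδ hd v w hunr hw h2 hδu p hQ
    obtain ⟨b, k, hbB, hkK, hwn, hb⟩ := exists_borel_mul_integral_eq_weylLong_mul_of_nonsplit L v w hw hw₀ hn hZ1 hXZ
    have hne : conjLocal L (IsCMField.complexConj L) v (toLocalRing L v (p 2) * algebraMap L (LocalRing L v) δ -
        toLocalRing L v 2⁻¹ * (quadraticLocalEquiv L v (IsCMField.complexConj L) hcδ hδ (p 0, p 1) * conjLocal L (IsCMField.complexConj L) v (quadraticLocalEquiv L v (IsCMField.complexConj L) hcδ hδ (p 0, p 1)))) w ≠ 0 := by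
      intro h0
      have := hv (toLocalRing L v (p 2) * algebraMap L (LocalRing L v) δ -
        toLocalRing L v 2⁻¹ * (quadraticLocalEquiv L v (IsCMField.complexConj L) hcδ hδ (p 0, p 1) * conjLocal L (IsCMField.complexConj L) v (quadraticLocalEquiv L v (IsCMField.complexConj L) hcδ hδ (p 0, p 1))))
      rw [h0, Valuation.map_zero] at this
      exact absurd hZ1 (by rw [← this]; exact not_le.2 zero_lt_one)
    refine ⟨b, k, hbB, hkK, hwn, ?_⟩
    dsimp only
    rw [hb, dif_neg hne, Units.val_mk0]
    rfl
  · -- (c-on): `u(p) ∈ K_v` and `w₀ ∈ K_v`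
    obtain ⟨hX1, hZ1⟩ := valued_le_one_of_localHeight_eq_one L hcδ hδ v w hw p hQ
    exact Subgroup.mul_mem _ (antidiag_mem_integralLevel L v hw₀) (heis_mem_integralLevel_of_valued_le_one L v w hw hn hX1 hZ1)

end Letters

end Summit.HodgeConjecture.HodgeConjecture.Cruxes.H413.K2E1BigCellIwasawaTorusEntryU3Letters

end
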